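import Mathlib
import Summits.Ventures.PercRepro2.SevenKernel

/-!
# The twelve-edge Kronecker certificates on seven-vertex skeletons, part 3: the two-hub family `K_{2,5} + uw + xy`
(blind cell PercRepro2, mine-2 g34; `SevenKernel.lean` carries the definitions; the bridge `SevenTyped.HCov_seven`
turns each certificate into (HCOV) on the skeleton for every weight vector)

The two-hub skeletons: the unmarked vertices `u = 5` and `w = 6` joined to every mark (edges `0..4` at `u`, `5..9` at
`w`), the hubs adjacent (edge `10`), and ONE mark–mark edge `x y` (edge `11`) — `hubxy`; the ten pairs are the ten
skeletons `hub01 … hub34`, each a `decide +kernel` of ≈ 135 s on the farm.  Census twin: mining/mine-2/code/g34/typed7.c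
(exact axis-wise convolution over the `2^12 × 2^12` pairs and the `3^12 × 2^12` completions, no Kronecker numbers):
the positive / zero / maximum class sums in the docstrings, 0 negative on every skeleton.
-/

namespace Summit.Ventures.PercRepro2

namespace Seven

/-- **The two-hub skeleton `hub12 = K_{2,5} + uw + a₁a₂`**: `u = 5`, `w = 6` joined to every mark, `u w`, and the
mark–mark edge `a₁ a₂` (edge `11`). -/
def hub12 : Fin 12 → Fin 7 × Fin 7 :=
  ![(0, 5), (1, 5), (2, 5), (3, 5), (4, 5), (0, 6), (1, 6), (2, 6), (3, 6), (4, 6), (5, 6), (1, 2)]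

set_option maxRecDepth 100000 in
/-- **The certificate of `hub12`**, marks `(o, a₁, a₂, a₃, b) = (0, 1, 2, 3, 4)`: every typed three-copy class sum
is `≥ 0`, by one `decide +kernel` (twin: 429,426 positive class sums, 16,347,790 zeros, maximum 16,472, 0 negative). -/
theorem cert_hub12 : Cert hub12 := by
  unfold Cert
  decide +kernel

/-- **The two-hub skeleton `hub13 = K_{2,5} + uw + a₁a₃`**: `u = 5`, `w = 6` joined to every mark, `u w`, and the
mark–mark edge `a₁ a₃` (edge `11`). -/
def hub13 : Fin 12 → Fin 7 × Fin 7 :=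
  ![(0, 5), (1, 5), (2, 5), (3, 5), (4, 5), (0, 6), (1, 6), (2, 6), (3, 6), (4, 6), (5, 6), (1, 3)]

set_option maxRecDepth 100000 in
/-- **The certificate of `hub13`**, marks `(o, a₁, a₂, a₃, b) = (0, 1, 2, 3, 4)`: every typed three-copy class sum
is `≥ 0`, by one `decide +kernel` (twin: 1,241,472 positive class sums, 15,535,744 zeros, maximum 25,352, 0 negative). -/
theorem cert_hub13 : Cert hub13 := by
  unfold Cert
  decide +kernel

end Seven

end Summit.Ventures.PercRepro2
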